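/-
Copyright (c) 2026 the pub-hodgecm-mathlib formalisation cell (harness21).  Prover seat hodgecm-mathlib-K2E5-p16 (g4): Track B «K2-LIT»,
hLiu418 = stmt-HodgeConjecture-24832, ROAD Φ organ Φ6b (symmetries): `h ↦ −h` for Shimura's `η` and `ξ` on `Herm₂(ℂ)` and the ξ–η identity for
NEGATIVE (semi)definite `h` — the `h < 0` Fourier coefficients; 2026-09-04.
-/
import Summits.HodgeConjecture.HodgeConjecture.Theorems.K2LiuHermTwoXiEtaIdentitySemidefinite  -- ★ p858077 (this seat): identity for `h ≥ 0`
import HarnessLib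

/-!
# Crux `HLiu418`, ROAD Φ, organ Φ6b (symmetries): `η(g, −h; α, β) = η(g, h; β, α)`, `ξ(g, −h; α, β) = e^{2πi(β−α)} ξ(g, h; β, α)`,
# and the ξ–η identity for `h ≤ 0` [Shimura1982, (1.28)–(1.29), (3.2), Case II, m = κ = 2]

Cell `hodgecm-mathlib`, crux item hLiu418 = `stmt-HodgeConjecture-24832`, route of record `HCCMUnconditional`; squad K2, LEAD F0P6-plan (g12), co-dealer
K2E5-plan (g5), prover K2E5-p16 (g4).  THEOREMS ONLY; lane `--supports stmt-HodgeConjecture-24832 --as helper`.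

* `etaTwoSet_neg`, `etaTwoIntegrand_neg`, `etaTwo_neg`: `η(g, −h; α, β) = η(g, h; β, α)` (the domain `{x ± h > 0}` is symmetric, the two
  determinant powers swap).
* `integral_comp_neg_chart` (`x ↦ −x` preserves Lebesgue measure on the chart), `hermTwo_neg`, `xiTwoIntegrand_neg`, `xiTwo_neg`:
  `ξ(g, −h; α, β) = e^{2πi(β−α)} ξ(g, h; β, α)` (substitute `x ↦ −x`; `det(−M) = det M` for `2 × 2`; the phases `e^{∓iπ·}` of ★ `xiTwo` swap).
* `xiTwo_eq_etaTwo_of_neg_posSemidef` ∕ `_of_neg_posDef`: for `g > 0`, `−h ≥ 0`, `re α > 1`, `re β > 3`: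
  `ξ(g, h; α, β) = 4π⁴ · e^{iπ(β−α)} · Γ₂(α)⁻¹ Γ₂(β)⁻¹ · η(2g, −πh; β, α)` — the `h ≤ 0` half of the Fourier coefficients, from ★
  `xiTwo_eq_etaTwo_of_posSemidef` at `(−h; β, α)`.
HONEST LABEL.  Count-neutral helper of the K2_Liu road; it pays no socket by itself: `HC_CM` is proved only modulo the 7 printed citations
(2 remaining named inputs: hLiu418 = `stmt-HodgeConjecture-24832`, h413 = `stmt-HodgeConjecture-24833`) until rung 0 closes.
-/

set_option autoImplicit false
-- the mandated namespace repeats the single-problem summit's segment (`HodgeConjecture.HodgeConjecture`)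
set_option linter.dupNamespace false

noncomputable section

open Complex MeasureTheory Set
open scoped ComplexOrder ComplexConjugate

namespace Summit.HodgeConjecture.HodgeConjecture.Cruxes.HLiu418.K2LiuHermTwoXiEtaSymmetry

open Summit.HodgeConjecture.HodgeConjecture.Cruxes.HLiu418.K2LiuHermTwoGammaDefs
open Summit.HodgeConjecture.HodgeConjecture.Cruxes.HLiu418.K2LiuHermTwoConfluentXiDefs
open Summit.HodgeConjecture.HodgeConjecture.Cruxes.HLiu418.K2LiuHermTwoEtaDefs
open Summit.HodgeConjecture.HodgeConjecture.Cruxes.HLiu418.K2LiuHermTwoXiEtaIdentity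
open Summit.HodgeConjecture.HodgeConjecture.Cruxes.HLiu418.K2LiuHermTwoXiEtaIdentitySemidefinite

/-! ## `η` under `h ↦ −h` -/

/-- The domain of `η` is symmetric: `{x ± (−h) > 0} = {x ± h > 0}`. -/
theorem etaTwoSet_neg (h : Matrix (Fin 2) (Fin 2) ℂ) : etaTwoSet (-h) = etaTwoSet h := by
  ext c
  rw [mem_etaTwoSet_iff, mem_etaTwoSet_iff, ← sub_eq_add_neg, sub_neg_eq_add]
  exact and_comm

/-- The integrand of `η(g, −h; α, β)` is the integrand of `η(g, h; β, α)`. -/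
theorem etaTwoIntegrand_neg (g h : Matrix (Fin 2) (Fin 2) ℂ) (α β : ℂ) (c : ℝ × ℂ × ℝ) :
    etaTwoIntegrand g (-h) α β c = etaTwoIntegrand g h β α c := by
  rw [etaTwoIntegrand_apply, etaTwoIntegrand_apply, ← sub_eq_add_neg, sub_neg_eq_add, mul_comm ((hermTwo c - h).det ^ (α - 2))]

/-- **`η(g, −h; α, β) = η(g, h; β, α)`** [Shimura1982, (3.2)]. -/
theorem etaTwo_neg (g h : Matrix (Fin 2) (Fin 2) ℂ) (α β : ℂ) : etaTwo g (-h) α β = etaTwo g h β α := by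
  rw [etaTwo_def, etaTwo_def, etaTwoSet_neg]
  simp_rw [etaTwoIntegrand_neg]

/-! ## `ξ` under `h ↦ −h` -/

/-- `x ↦ −x` preserves Lebesgue measure on the chart: `∫ f(−x) dx = ∫ f(x) dx`. -/
theorem integral_comp_neg_chart (f : ℝ × ℂ × ℝ → ℂ) : ∫ c : ℝ × ℂ × ℝ, f (-c) = ∫ c, f c := by
  have h := ((Measure.measurePreserving_neg (volume : Measure ℝ)).prod
    ((Measure.measurePreserving_neg (volume : Measure ℂ)).prod (Measure.measurePreserving_neg (volume : Measure ℝ))))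
  have hf : (fun c : ℝ × ℂ × ℝ => -c) = Prod.map (fun x : ℝ => -x) (Prod.map (fun x : ℂ => -x) (fun x : ℝ => -x)) := by
    funext c
    rfl
  have hT : MeasurePreserving (fun c : ℝ × ℂ × ℝ => -c) volume volume := by
    rw [hf, Measure.volume_eq_prod, Measure.volume_eq_prod]
    exact h
  exact hT.integral_comp (MeasurableEquiv.neg (ℝ × ℂ × ℝ)).measurableEmbedding f

/-- `hermTwo (−c) = −hermTwo c`. -/
theorem hermTwo_neg (c : ℝ × ℂ × ℝ) : hermTwo (-c) = -hermTwo c := by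
  rw [← zero_sub, hermTwo_sub, hermTwo_zero, zero_sub]

/-- The integrand of `ξ(g, −h; α, β)` at `−x` is `e^{2πi(β−α)}` times the integrand of `ξ(g, h; β, α)` at `x`. -/
theorem xiTwoIntegrand_neg (g h : Matrix (Fin 2) (Fin 2) ℂ) (α β : ℂ) (c : ℝ × ℂ × ℝ) :
    xiTwoIntegrand g (-h) α β (-c) = cexp (2 * Real.pi * I * (β - α)) * xiTwoIntegrand g h β α c := by
  rw [xiTwoIntegrand_eq, xiTwoIntegrand_eq, hermTwo_neg, neg_mul_neg, smul_neg, sub_neg_eq_add, ← sub_eq_add_neg,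
    mul_comm ((g + I • hermTwo c).det ^ (-α))]
  have hph : cexp ((Real.pi * I) * (β - α)) = cexp (2 * Real.pi * I * (β - α)) * cexp ((Real.pi * I) * (α - β)) := by
    rw [← Complex.exp_add]
    congr 1
    ring
  rw [hph]
  ring

/-- **`ξ(g, −h; α, β) = e^{2πi(β−α)} ξ(g, h; β, α)`** (substitution `x ↦ −x`; [Shimura1982, (1.28)]). -/
theorem xiTwo_neg (g h : Matrix (Fin 2) (Fin 2) ℂ) (α β : ℂ) :
    xiTwo g (-h) α β = cexp (2 * Real.pi * I * (β - α)) * xiTwo g h β α := by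
  have h1 := integral_comp_neg_chart (xiTwoIntegrand g (-h) α β)
  rw [xiTwo_def, xiTwo_def, ← h1]
  simp_rw [xiTwoIntegrand_neg]
  exact integral_const_mul _ _

/-! ## The ξ–η identity for `h ≤ 0` -/

/-- **THE ξ–η IDENTITY FOR `h ≤ 0`**: for `g > 0`, `−h ≥ 0` (any rank), `re α > 1` and `re β > 3`,
  `ξ(g, h; α, β) = 4π⁴ · e^{iπ(β−α)} · Γ₂(α)⁻¹ · Γ₂(β)⁻¹ · η(2g, −πh; β, α)`. -/
theorem xiTwo_eq_etaTwo_of_neg_posSemidef {g h : Matrix (Fin 2) (Fin 2) ℂ} (hg : g.PosDef) (hh : (-h).PosSemidef) {α β : ℂ}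
    (hα : 1 < α.re) (hβ : 3 < β.re) :
    xiTwo g h α β =
      ((4 * Real.pi ^ 4 : ℝ) : ℂ) * cexp ((Real.pi * I) * (β - α)) * (hermTwoGamma α)⁻¹ * (hermTwoGamma β)⁻¹ *
        etaTwo ((2 : ℂ) • g) ((Real.pi : ℂ) • (-h)) β α := by
  have h1 := xiTwo_neg g (-h) α β
  rw [neg_neg] at h1
  rw [h1, xiTwo_eq_etaTwo_of_posSemidef hg hh hβ hα]
  have hph : cexp (2 * Real.pi * I * (β - α)) * cexp ((Real.pi * I) * (α - β)) = cexp ((Real.pi * I) * (β - α)) := by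
    rw [← Complex.exp_add]
    congr 1
    ring
  rw [← hph]
  ring

/-- The same for negative DEFINITE `h`. -/
theorem xiTwo_eq_etaTwo_of_neg_posDef {g h : Matrix (Fin 2) (Fin 2) ℂ} (hg : g.PosDef) (hh : (-h).PosDef) {α β : ℂ}
    (hα : 1 < α.re) (hβ : 3 < β.re) :
    xiTwo g h α β =
      ((4 * Real.pi ^ 4 : ℝ) : ℂ) * cexp ((Real.pi * I) * (β - α)) * (hermTwoGamma α)⁻¹ * (hermTwoGamma β)⁻¹ *
        etaTwo ((2 : ℂ) • g) ((Real.pi : ℂ) • (-h)) β α :=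
  xiTwo_eq_etaTwo_of_neg_posSemidef hg hh.posSemidef hα hβ

end Summit.HodgeConjecture.HodgeConjecture.Cruxes.HLiu418.K2LiuHermTwoXiEtaSymmetry

end
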